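import Summits.BirchSwinnertonDyer.Rank1Residual.AdditivePotMult.PotMultTateLineAllLevel
import Summits.BirchSwinnertonDyer.Rank1Residual.Additive.GreenbergKummerTwistDescentGeom
import Summits.BirchSwinnertonDyer.Rank1Residual.GaloisImage.GreenbergKerTwistTransport
import Summits.BirchSwinnertonDyer.Rank1Residual.GaloisImage.GreenbergStrictOfNoInertiaInvariants
import Summits.BirchSwinnertonDyer.Rank1Residual.Additive.GreenbergKummerTameDescent
import Summits.BirchSwinnertonDyer.Rank1Residual.GaloisImage.GreenbergKerCoprimeAscent
import Summits.BirchSwinnertonDyer.Rank1Residual.AdditivePotMult.TwistDescent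
import HarnessLib

/-!
# R-D ON THE (M) ROWS: the ramified ordinary line `C` of an additive potentially multiplicative
# `(E, p)` satisfies `Im κ = Im λ_C` (Kummer = Greenberg = strict) over the cyclotomic `ℚ_∞` — a
# KERNEL THEOREM modulo the published Tate uniformisation ONLY (cell `b2b-bsdres`, team n1011, seat
# p07 (gen 5), row T-RD-M = the (M) instance of r2's ROUTE-2 §II.15.3 ARM δ / n1011-p05's T-RD-Δ-K;
# assembly of p07 `PotMultTateKummerPackage` / `PotMultTateLineAllLevel` + `GreenbergKerCoprimeAscent`, n1011-p05
# `GreenbergKerTwistTransport` + `GreenbergKummerTameDescent` + `GreenbergKummerTwistDescentGeom` +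
# `GreenbergStrictOfNoInertiaInvariants`)

HONEST FRAMING (cell `b2b-bsdres`, run/shared/lean/b2b/bsd-rank1-residual/, verbatim in every
file): the goal of the cell is to DELETE the COMBINATION-SHAPED residual classes of the
Birch–Swinnerton-Dyer formula for ALL analytic-rank `≤ 1` elliptic curves over `ℚ` — "full BSD
formula for every rank `≤ 1` curve in class `C`" assembled STRICTLY from published theorems — so
that the rank-`≤ 1` remainder becomes exactly the CONSTRUCTION-SHAPED classes, which are TYPED
(missing-input `Prop`s), NOT attempted. This is not "finishing BSD". Team n1011 (N10/N11; the local
identification `R-D` behind Route G's EPW consumers on the (M) rows X4(M)/X3♯(M)): research route;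
labels and marks UNCHANGED; nothing booked. Theorems only; NO definition; NO Literature fact minted;
the ONLY named facts are the PUBLISHED Tate uniformisation A40/A41 (Silverman *ATAEC* V.3.1 / V.5.3 /
V.5.4, hypotheses `hT40`/`hT41`, as in every X2 Tate file). Debt 0.

## What

For `E = W` additive and potentially multiplicative at the odd prime `p` (`PotMult W p`; every X4(M)
and X3♯(M) row, `p = 3` included), `κ` the cyclotomic `ℤ_p`-extension (`H' = ker κ = Gal(ℚ̄/ℚ_∞)`),
`v` the place above `p`: there is a Greenberg local datum `L` on `E[p^∞]` at `v` with
* `IsRamifiedOrdinaryLine W p L` (EPW's `A'_{f̃,a}`, the binder of Route G's EPW fact) — the Tate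
  line `C_v ≅ μ_{p^∞}` of the multiplicative twist model `V = E♭` (`C • V^{(p*)} = W`) transported
  along the COORDINATE twist transport `t = twistPrimaryEquiv⁻¹ ≫ primaryIso` (additive-p1's
  isomorphism, for which the local Kummer square is in the tree; n1011-p05
  `GreenbergKummerTwistDescentGeom` §1–§2) — a second construction beside TB-ROL B-M's
  `psiQ`-transported line (same FILE A lemma `isRamifiedOrdinaryLine_twistMap`);
* `L.strictKer (ker κ ⊓ Gal(ℚ̄/K)) ≤ W.localKerOver p (ker κ ⊓ Gal(ℚ̄/K)) ℚ_p`, `K = ℚ(√p*)` — over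
  `K·ℚ_∞`, where `E ≅ V`: X2's THEOREM `strictKer_le_localKerOver_tate` for `V` (Greenberg p. 76,
  continuous Hilbert 90; p07 `exists_tateDatum_package_kummer`) carried to `E` by the two transports
  along the SAME isomorphism (strict: n1011-p05 `mem_strictKer_iff_h1Equiv_mem_twistMap`; Kummer:
  n1011-p05 `mem_localKerOver_iff_h1Equiv_geomTransport` over additive-p1's local square);
* `L.strictKer (ker κ) ≤ W.localKerOver p (ker κ) ℚ_p` — "`Im λ_C ⊆ Im κ` over `ℚ_{∞,w}`": the
  prime-to-`p` DESCENT `[K·ℚ_∞ : ℚ_∞] = 2`, `p` odd (n1011-p05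
  `TameDescent.strictKer_le_localKerOver_kerSubgroup_of_index_coprime`, additive-p1
  `coprime_index_galRange`);
* `L.greenbergKer (ker κ) = L.strictKer (ker κ)` — the inertia group of `ℚ_∞` at `w` acts by `−1` on
  `E[p^∞]/C ≅ (V[p^∞]/C_v) ⊗ χ_{p*}` (n1011-p05 `exists_inertiaIn_kerSubgroup_map_smul_eq_neg` +
  `smul_eq_neg_twistMap_gr` + `greenbergKer_eq_strictKer_of_smul_eq_neg`);
* the CONVERSE `W.localKerOver p (ker κ) ℚ_p ≤ L.greenbergKer (ker κ)` — "`Im κ ⊆` Greenberg" — NOT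
  by the datum's inertia Kummer compatibility (which FAILS at finite level for the transported Tate
  datum of the additive `W`: for `σ ∈ I_p` with `χ_{p*}(σ) = −1` and `P = Ψ(q^{1/p})`, `σP − P` is a
  `p`-torsion point outside `C`), but by ASCENT from `K·ℚ_∞`: there `W ≅ V`, `V`'s Tate datum HAS
  the compatibility (`tateDatum_kummer`, p07 `exists_tateDatum_package_kummer` clause (vi)), and
  Greenberg's condition ascends along the prime-to-`p` step because restriction
  `H¹(I(ℚ_∞), D) → H¹(I(K·ℚ_∞), D)` is injective (p07 `GreenbergKerCoprimeAscent`, on n1011-p05's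
  `resOfLe_injective_of_coprime`).
Hence the EQUALITIES `L.greenbergKer (ker κ) = W.localKerOver p (ker κ) ℚ_p = L.strictKer (ker κ)`:
the R-D identification "`Sel_{p^∞}(E/ℚ_∞)` has Greenberg's local condition at `w ∣ p` for the
ramified ordinary line" — the (M)-row twin, as a THEOREM, of the cited A111
(`GreenbergVatsal2000.imKummer_ge_greenbergCondition_at_p`, good ordinary `p`) / A120 (multiplicative
`p`) / cc-typer-2's p262636 (good ordinary over the tame field), and exactly the shape of cc-typer-2's
δ-binder `hRD : L.greenbergKer κ.kerSubgroup = W.localKerOver p κ.kerSubgroup ℚ_v` (p264989) FOR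
THIS LINE. This retires, on the (M) locus, the reading flag `CG96-via-Coates99` of
`EmertonPollackWeston2006/NearlyOrdinaryAlgebraicTransfer` WITHOUT Coates–Greenberg 1996: no fact
beyond A40/A41 enters.

HONEST LIMIT (not claimed): UNIQUENESS of the ramified ordinary line — the identification is proved
for the line constructed here (TB-ROL B-M's `psiQ`-transported line is a second construction; every
EPW/GV consumer quantifies `∃ L`, but cc-typer-2's `Additive.RamifiedLineKummerEqAt` quantifies
`∀ L` and is therefore NOT yet discharged on (M)); `p = 2`. X4(M)/X3♯(M) stay CONSTRUCTION-SHAPED;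
nothing booked.

References: R. Greenberg, LNM 1716 (1999) §2 pp. 69–76 (Props. 2.2, 2.4, the multiplicative remark)
and §5 p. 143; R. Greenberg, V. Vatsal, Invent. Math. 142 (2000) §2 pp. 14–16, 26; J. Coates,
R. Greenberg, Invent. Math. 124 (1996) Props. 4.3, 4.8 (the printed source of R-D at a deeply ramified prime, NOT used);
M. Emerton, R. Pollack, T. Weston, Invent. Math. 163 (2006) §3.1; J. H. Silverman, *ATAEC* V.3.1,
V.5.2–5.4, *AEC* X.5 Cor. 5.4; J.-P. Serre, *Local Fields* X §1 Prop. 2, Invent. Math. 15 (1972) §1.3.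
-/

noncomputable section

open scoped Classical NumberField AddSubgroup

universe u

namespace Summit.BirchSwinnertonDyer.Rank1Residual.AdditivePotMult

open NumberField IsDedekindDomain Field WeierstrassCurve
  Literature.NumberTheory.EllipticCurves
  Literature.NumberTheory.EllipticCurves.GreenbergSelmer
  Literature.NumberTheory.EllipticCurves.EmertonPollackWeston2006
  Literature.NumberTheory.GaloisRepresentations
  Literature.NumberTheory.EllipticCurves.Rank1Residual
  Summit.BirchSwinnertonDyer.Rank1Residual.X2
  Summit.BirchSwinnertonDyer.Rank1Residual.GaloisImage
  Summit.BirchSwinnertonDyer.Rank1Residual.GaloisImage.RamifiedOrdinaryLineTwist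
  Summit.BirchSwinnertonDyer.Rank1Residual.Additive.TameDescent
  Summit.BirchSwinnertonDyer.Rank1Residual.Additive

namespace PotMultGreenbergKummer

/-! ### §1 Twist level: `C • V^{(c)} = W`, `V` multiplicative at `p`, `ord_v c = 1` -/

section Twist

variable (V : WeierstrassCurve ℚ) [V.IsGloballyMinimal] [V.IsElliptic] (K : Type) [Field K]
  [NumberField K] (h2 : Module.finrank ℚ K = 2) {θ : K} {c : ℚ} (hθ : θ ∉ Set.range (algebraMap ℚ K))
  (hc : θ ^ 2 = algebraMap ℚ K c) (p : ℕ) [hp : Fact p.Prime] {W : WeierstrassCurve ℚ}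
  {C : VariableChange ℚ} (hC : C • V.quadraticTwist c = W)

include h2 hθ hc hC in
/-- **R-D for the twist of a multiplicative curve, over `K·ℚ_∞` and over `ℚ_∞`.** `C • V^{(c)} = W`
with `V` globally minimal and MULTIPLICATIVE at the odd prime `p`, `K = ℚ(θ)`, `θ² = c`, `ord_v c = 1`
(so `K/ℚ` is ramified at `p`), `κ` the cyclotomic `ℤ_p`-extension, A40/A41 granted. Then for the Tate
line of `V` transported along `t = twistPrimaryEquiv⁻¹ ≫ primaryIso` — a Greenberg local datum `L` of
`W` at `v` —:
(1) `IsRamifiedOrdinaryLine W p L`, with the QUOTIENT SHAPE (`res σ • x ∓ x ∈ C` by the sign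
`χ_c(res σ)`) of TB-ROL B-M and the LINE SHAPE AT ALL LEVELS (`χ(σ) = k` in `ℤ_p` ⟹ `res σ • m = ±k • m`
for EVERY `m ∈ C`, `PotMultTateLineAllLevel`) — so the line-matching theorems of
`RamifiedOrdinaryLineMatching[Mixed]` run verbatim for this line, and the uniqueness argument gets its
element `σ₁` (`χ(σ₁) = 1 + p`) acting on all of `C`;
(2) over `K·ℚ_∞` (`H = ker κ ⊓ galRange K`, where `W ≅ V`):
`L.strictKer H ≤ W.localKerOver p H ℚ_v` (X2's theorem for `V` + the two twist transports);
(3) over `ℚ_∞`: `L.strictKer (ker κ) ≤ W.localKerOver p (ker κ) ℚ_v` (prime-to-`p` descent,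
`[K·ℚ_∞ : ℚ_∞] = 2`); (4) `L.greenbergKer (ker κ) = L.strictKer (ker κ)` (an inertial element of
`Gal(ℚ̄/ℚ_∞)` acts by `−1` on `W[p^∞]/C`); (5) the converse `W.localKerOver p (ker κ) ℚ_v ≤
L.greenbergKer (ker κ)` (transport of `V`'s Kummer compatibility at level `K·ℚ_∞` + ASCENT); (6) the
equalities `L.greenbergKer (ker κ) = W.localKerOver p (ker κ) ℚ_v = L.strictKer (ker κ)`.
[cite: GreenbergLNM1716, §2 pp. 74–76 (Prop. 2.4 and the multiplicative remark), §5 p. 143]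
[cite: GreenbergVatsal2000, §2 pp. 14–16 and p. 26] [cite: SilvermanATAEC1994, Ch. V Thm. 3.1 (c),(d), Thm. 5.3, Cor. 5.4]
[cite: SilvermanAEC2009, X.5 Cor. 5.4] [cite: SerreLocalFields1979, Ch. X §1 Prop. 2] -/
theorem exists_line_kummer_of_mult_twist (hT40 : Silverman1994_thmV53_tateUniformisation.{0})
    (hT41 : Silverman1994_thmV53_corV54_tateUniformisation.{0}) (hp2 : p ≠ 2)
    (hmult : V.HasMultiplicativeReductionAtPrime p) (κ : ZpExtension ℚ p) (hκ : κ.IsCyclotomic)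
    {v : HeightOneSpectrum (𝓞 ℚ)} (hv : ((p : ℕ) : 𝓞 ℚ) ∈ v.asIdeal)
    (hval : v.valuation ℚ c = WithZero.exp (-1 : ℤ)) :
    ∃ L : LocalDatum ℚ (W.geomPrimaryTorsion p) v,
      IsRamifiedOrdinaryLine W p L ∧
      (∀ σ ∈ absInertia (v.adicCompletion ℚ),
        (absGaloisRestrict ℚ (v.adicCompletion ℚ) σ ∈ galRange (K := ℚ) K →
          ∀ x : W.geomPrimaryTorsion p,
            absGaloisRestrict ℚ (v.adicCompletion ℚ) σ • x - x ∈ L.plus) ∧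
        (absGaloisRestrict ℚ (v.adicCompletion ℚ) σ ∉ galRange (K := ℚ) K →
          ∀ x : W.geomPrimaryTorsion p,
            absGaloisRestrict ℚ (v.adicCompletion ℚ) σ • x + x ∈ L.plus)) ∧
      (∀ σ ∈ absInertia (v.adicCompletion ℚ), ∀ k : ℕ,
        ((GaloisRep.cyclotomicCharacter (v.adicCompletion ℚ) p σ : ℤ_[p]ˣ) : ℤ_[p]) = k →
        ∀ m ∈ L.plus,
          (absGaloisRestrict ℚ (v.adicCompletion ℚ) σ ∈ galRange (K := ℚ) K →
            absGaloisRestrict ℚ (v.adicCompletion ℚ) σ • m = k • m) ∧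
          (absGaloisRestrict ℚ (v.adicCompletion ℚ) σ ∉ galRange (K := ℚ) K →
            absGaloisRestrict ℚ (v.adicCompletion ℚ) σ • m = -(k • m))) ∧
      L.strictKer (κ.kerSubgroup ⊓ galRange (K := ℚ) K) ≤
        W.localKerOver p (κ.kerSubgroup ⊓ galRange (K := ℚ) K) (v.adicCompletion ℚ) ∧
      L.strictKer κ.kerSubgroup ≤ W.localKerOver p κ.kerSubgroup (v.adicCompletion ℚ) ∧
      L.greenbergKer κ.kerSubgroup = L.strictKer κ.kerSubgroup ∧
      W.localKerOver p κ.kerSubgroup (v.adicCompletion ℚ) ≤ L.greenbergKer κ.kerSubgroup ∧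
      L.greenbergKer κ.kerSubgroup = W.localKerOver p κ.kerSubgroup (v.adicCompletion ℚ) ∧
      L.strictKer κ.kerSubgroup = W.localKerOver p κ.kerSubgroup (v.adicCompletion ℚ) := by
  haveI : IsGalois ℚ K := isGalois_of_finrank_eq_two K h2
  haveI hKN : (galRange (K := ℚ) K).Normal := normal_galRange K h2 (sigmaQ_ne_one K h2 hθ hc)
  -- the Tate datum of `V` with both local inclusions at every level
  obtain ⟨N, htriv, hdiv, hcard, -, hstrict, hgreen, hall⟩ :=
    RamifiedOrdinaryLinePotMult.exists_tateDatum_package_all V p hT40 hT41 hp2 hmult hv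
  -- the coordinate twist transport and the transported line
  set t : V.geomPrimaryTorsion p ≃+ W.geomPrimaryTorsion p :=
    (twistPrimaryEquiv V K hθ hc p).symm.trans (primaryIso p hC) with ht
  have hsign := geomTransport_sign V K h2 hθ hc p hC
  have hanti := exists_mem_absInertia_geomTransport_smul_eq_neg V K h2 hθ hc p hC hp2 hv hval
  set L : LocalDatum ℚ (W.geomPrimaryTorsion p) v := twistMap N t hsign with hL
  -- (1) ramified ordinary line
  have h1 : IsRamifiedOrdinaryLine W p L :=
    isRamifiedOrdinaryLine_twistMap hp2 N t hsign hdiv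
      (RamifiedOrdinaryLinePotMult.plus_ne_top_of_natCard N hcard)
      (RamifiedOrdinaryLinePotMult.plus_ne_bot_of_natCard N hcard) htriv hanti
  -- (2) strict ⊆ Kummer over `K·ℚ_∞`, transported from `V`
  set H : Subgroup (absoluteGaloisGroup ℚ) := κ.kerSubgroup ⊓ galRange (K := ℚ) K with hH
  have hHK : H ≤ galRange (K := ℚ) K := inf_le_right
  have hθH : ∀ (g : H) (m : V.geomPrimaryTorsion p), t (g • m) = g • t m := fun g m ↦
    geomTransport_smul_of_mem V K hθ hc p hC (hHK g.2) m
  have h2' : L.strictKer H ≤ W.localKerOver p H (v.adicCompletion ℚ) := by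
    intro x hx
    set x₀ := (h1Equiv (G := H) t hθH).symm x with hx₀
    have hxx : h1Equiv (G := H) t hθH x₀ = x := by rw [hx₀, AddEquiv.apply_symm_apply]
    have h0 : x₀ ∈ N.strictKer H := by
      rw [mem_strictKer_iff_h1Equiv_mem_twistMap H N t hsign hθH x₀, hxx]
      exact hx
    have hK0 : x₀ ∈ V.localKerOver p H (v.adicCompletion ℚ) := hstrict H h0
    rw [← hxx]
    exact (mem_localKerOver_iff_h1Equiv_geomTransport V K hθ hc p hC H hHK hθH _ x₀).1 hK0
  -- (3) descent to `ℚ_∞`: `[H' : H] = 2` is prime to `p`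
  have h3 : L.strictKer κ.kerSubgroup ≤ W.localKerOver p κ.kerSubgroup (v.adicCompletion ℚ) :=
    TameDescent.strictKer_le_localKerOver_kerSubgroup_of_index_coprime W p L κ (isOpen_galRange K)
      (coprime_index_galRange K h2 hθ hc p hp2) h2'
  -- (4) Greenberg = strict over `ℚ_∞`: an inertial element of `Gal(ℚ̄/ℚ_∞)` acts by `−1` on `W[p^∞]/C`
  obtain ⟨τ, hτ⟩ := exists_inertiaIn_kerSubgroup_map_smul_eq_neg K h2 hθ hc p t κ hκ hp2 hv
    (fun g hg m ↦ geomTransport_smul_of_mem V K hθ hc p hC hg m) hanti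
  have hτI : ((τ : decomp (K := ℚ) v) : absoluteGaloisGroup ℚ) ∈ inertia v :=
    ((mem_inertiaIn_iff κ.kerSubgroup v _).1 τ.2).2
  have htrivGr : ∀ d : N.Gr, (τ : decomp (K := ℚ) v) • d = d := by
    intro d
    obtain ⟨m, rfl⟩ := N.grMk_surjective d
    rw [LocalDatum.smul_grMk, ← sub_eq_zero, ← map_sub, ← AddMonoidHom.mem_ker, LocalDatum.ker_grMk]
    exact htriv _ hτI m
  have hneg : ∀ d : L.Gr, τ • d = -d := fun d ↦
    smul_eq_neg_twistMap_gr N t hsign (τ : decomp (K := ℚ) v) hτ htrivGr d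
  have hGr : ∀ d : L.Gr, ∃ k : ℕ, p ^ k • d = 0 := by
    intro d
    obtain ⟨m, rfl⟩ := L.grMk_surjective d
    obtain ⟨k, hk⟩ := (AddCommGroup.mem_primaryComponent).1 m.2
    refine ⟨k, ?_⟩
    rw [← map_nsmul]
    have hm0 : p ^ k • m = 0 := Subtype.ext (by exact_mod_cast hk)
    rw [hm0, map_zero]
  have h4 : L.greenbergKer κ.kerSubgroup = L.strictKer κ.kerSubgroup :=
    greenbergKer_eq_strictKer_of_smul_eq_neg κ.kerSubgroup L hp2 hGr τ hneg
  -- (5) the converse: `V`'s Kummer compatibility at level `H`, transported, then ASCENT to `ℚ_∞`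
  have h5H : W.localKerOver p H (v.adicCompletion ℚ) ≤ L.greenbergKer H := by
    intro x hx
    set x₀ := (h1Equiv (G := H) t hθH).symm x with hx₀
    have hxx : h1Equiv (G := H) t hθH x₀ = x := by rw [hx₀, AddEquiv.apply_symm_apply]
    have hK0 : x₀ ∈ V.localKerOver p H (v.adicCompletion ℚ) := by
      rw [mem_localKerOver_iff_h1Equiv_geomTransport V K hθ hc p hC H hHK hθH _ x₀, hxx]
      exact hx
    have h0 : x₀ ∈ N.greenbergKer H := hgreen H hK0
    rw [← hxx]
    exact (mem_greenbergKer_iff_h1Equiv_mem_twistMap H N t hsign hθH x₀).1 h0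
  have h5 : W.localKerOver p κ.kerSubgroup (v.adicCompletion ℚ) ≤ L.greenbergKer κ.kerSubgroup :=
    localKerOver_le_greenbergKer_kerSubgroup_of_index_coprime W p L κ (isOpen_galRange K)
      (coprime_index_galRange K h2 hθ hc p hp2) h5H
  have h6 : L.greenbergKer κ.kerSubgroup = W.localKerOver p κ.kerSubgroup (v.adicCompletion ℚ) :=
    le_antisymm (h4.le.trans h3) h5
  -- the inertia SHAPES of the transported line (as in TB-ROL B-M, along `t`)
  have hq : ∀ σ ∈ absInertia (v.adicCompletion ℚ),
      (absGaloisRestrict ℚ (v.adicCompletion ℚ) σ ∈ galRange (K := ℚ) K →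
        ∀ x : W.geomPrimaryTorsion p, absGaloisRestrict ℚ (v.adicCompletion ℚ) σ • x - x ∈ L.plus) ∧
      (absGaloisRestrict ℚ (v.adicCompletion ℚ) σ ∉ galRange (K := ℚ) K →
        ∀ x : W.geomPrimaryTorsion p, absGaloisRestrict ℚ (v.adicCompletion ℚ) σ • x + x ∈ L.plus) := by
    intro σ hσ
    refine ⟨fun hg x ↦ ?_, fun hg x ↦ ?_⟩
    · exact RamifiedOrdinaryLinePotMult.smul_sub_mem_twistMap_of_pos N t hsign
        (htriv _ (Subgroup.mem_map.2 ⟨σ, hσ, rfl⟩)) (geomTransport_smul_of_mem V K hθ hc p hC hg) x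
    · exact RamifiedOrdinaryLinePotMult.smul_add_mem_twistMap_of_neg N t hsign
        (htriv _ (Subgroup.mem_map.2 ⟨σ, hσ, rfl⟩)) (geomTransport_smul_of_not_mem V K h2 hθ hc p hC hg) x
  have hl : ∀ σ ∈ absInertia (v.adicCompletion ℚ), ∀ k : ℕ,
      ((GaloisRep.cyclotomicCharacter (v.adicCompletion ℚ) p σ : ℤ_[p]ˣ) : ℤ_[p]) = k →
      ∀ m ∈ L.plus,
        (absGaloisRestrict ℚ (v.adicCompletion ℚ) σ ∈ galRange (K := ℚ) K →
          absGaloisRestrict ℚ (v.adicCompletion ℚ) σ • m = k • m) ∧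
        (absGaloisRestrict ℚ (v.adicCompletion ℚ) σ ∉ galRange (K := ℚ) K →
          absGaloisRestrict ℚ (v.adicCompletion ℚ) σ • m = -(k • m)) := by
    intro σ hσ k hχ m hm
    have hcm : t.symm m ∈ N.plus := (mem_twistMap_plus_iff N t hsign m).1 hm
    refine ⟨fun hg ↦ ?_, fun hg ↦ ?_⟩
    · have h := RamifiedOrdinaryLinePotMult.smul_apply_eq_of_pos t
        (geomTransport_smul_of_mem V K hθ hc p hC hg) (hall σ hσ k hχ _ hcm)
      rwa [t.apply_symm_apply] at h
    · have h := RamifiedOrdinaryLinePotMult.smul_apply_eq_of_neg t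
        (geomTransport_smul_of_not_mem V K h2 hθ hc p hC hg) (hall σ hσ k hχ _ hcm)
      rwa [t.apply_symm_apply] at h
  exact ⟨L, h1, hq, hl, h2', h3, h4, h5, h6, h4.symm.trans h6⟩

end Twist

end PotMultGreenbergKummer

/-! ### §2 The (M) classes: `p*`-twist models; X4(M) and X3♯(M) -/

section Classes

variable {W : WeierstrassCurve ℚ} [W.IsElliptic] {p : ℕ} [hp : Fact p.Prime]

/-- **R-D on a potentially multiplicative row, EVERY odd `p` (`p = 3` included), mod A40/A41.** For
`E = W` additive and potentially multiplicative at `p` (`PotMult W p`), the cyclotomic `ℤ_p`-extension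
`κ` and the place `v ∋ p`: there is a ramified ordinary line `L` of `E` at `v` (EPW's binder) with
`L.greenbergKer (ker κ) = W.localKerOver p (ker κ) ℚ_v = L.strictKer (ker κ)` — over `ℚ_∞` the
classical Selmer condition at `w ∣ p` IS Greenberg's (and the strict) condition for `L` (§1 on the
multiplicative `p*`-twist model, `K = ℚ(√p*)`). Uniqueness of `L` is NOT claimed (module docstring). [cite: GreenbergLNM1716, §2 pp. 74–76 and §5 p. 143]
[cite: SilvermanATAEC1994, Ch. V Thm. 5.3, Cor. 5.4] [cite: SilvermanAEC2009, X.5 Cor. 5.4] -/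
theorem PotMult.exists_isRamifiedOrdinaryLine_kummer
    (hT40 : Silverman1994_thmV53_tateUniformisation.{0})
    (hT41 : Silverman1994_thmV53_corV54_tateUniformisation.{0}) (hp2 : p ≠ 2) (hpm : PotMult W p)
    (κ : ZpExtension ℚ p) (hκ : κ.IsCyclotomic)
    {v : HeightOneSpectrum (𝓞 ℚ)} (hv : ((p : ℕ) : 𝓞 ℚ) ∈ v.asIdeal) :
    ∃ L : LocalDatum ℚ (W.geomPrimaryTorsion p) v,
      IsRamifiedOrdinaryLine W p L ∧
      L.greenbergKer κ.kerSubgroup = W.localKerOver p κ.kerSubgroup (v.adicCompletion ℚ) ∧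
      L.strictKer κ.kerSubgroup = W.localKerOver p κ.kerSubgroup (v.adicCompletion ℚ) := by
  obtain ⟨V, _, _, C, hV, hC⟩ := hpm.exists_mult_pStar_twist_model hp2
  obtain ⟨K, _, _, hK2, θ, hθ, hθ2⟩ := RamifiedOrdinaryLinePotMult.exists_numberField_sq_eq_pStar hp2
  obtain ⟨L, h1, -, -, -, -, -, -, h6, h7⟩ :=
    PotMultGreenbergKummer.exists_line_kummer_of_mult_twist V K hK2 hθ hθ2 p hC hT40 hT41 hp2 hV κ hκ
      hv (RamifiedOrdinaryLinePotMult.valuation_pStar p v hv)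
  exact ⟨L, h1, h6, h7⟩

/-- **X4(M), every odd `p` (`p = 3` included): R-D over `ℚ_∞` — `Im κ = Greenberg = strict` — for a
ramified ordinary line** (the EPW binder of Route G's consumers), mod A40/A41. X4(M) stays CONSTRUCTION-SHAPED; nothing booked.
[cite: GreenbergLNM1716, §2 pp. 74–76] [cite: SilvermanATAEC1994, Ch. V Thm. 5.3, Cor. 5.4] -/
theorem ClassX4M.exists_isRamifiedOrdinaryLine_kummer
    (hT40 : Silverman1994_thmV53_tateUniformisation.{0})
    (hT41 : Silverman1994_thmV53_corV54_tateUniformisation.{0}) (hX : ClassX4M W p)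
    (κ : ZpExtension ℚ p) (hκ : κ.IsCyclotomic)
    {v : HeightOneSpectrum (𝓞 ℚ)} (hv : ((p : ℕ) : 𝓞 ℚ) ∈ v.asIdeal) :
    ∃ L : LocalDatum ℚ (W.geomPrimaryTorsion p) v,
      IsRamifiedOrdinaryLine W p L ∧
      L.greenbergKer κ.kerSubgroup = W.localKerOver p κ.kerSubgroup (v.adicCompletion ℚ) ∧
      L.strictKer κ.kerSubgroup = W.localKerOver p κ.kerSubgroup (v.adicCompletion ℚ) :=
  (ClassX4M.potMult W p hX).exists_isRamifiedOrdinaryLine_kummer hT40 hT41 hX.p_ne_two κ hκ hv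

/-- **X3♯(M), every odd `p` (`p = 3` included): R-D over `ℚ_∞` — `Im κ = Greenberg = strict` — for
a ramified ordinary line**, mod A40/A41 (no image hypothesis anywhere — R8). X3♯(M) stays CONSTRUCTION-SHAPED; nothing booked.
[cite: GreenbergLNM1716, §2 pp. 74–76] [cite: SilvermanATAEC1994, Ch. V Thm. 5.3, Cor. 5.4] -/
theorem ClassX3M.exists_isRamifiedOrdinaryLine_kummer [W.IsGloballyMinimal]
    (hT40 : Silverman1994_thmV53_tateUniformisation.{0})
    (hT41 : Silverman1994_thmV53_corV54_tateUniformisation.{0}) (hX : ClassX3M W p)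
    (κ : ZpExtension ℚ p) (hκ : κ.IsCyclotomic)
    {v : HeightOneSpectrum (𝓞 ℚ)} (hv : ((p : ℕ) : 𝓞 ℚ) ∈ v.asIdeal) :
    ∃ L : LocalDatum ℚ (W.geomPrimaryTorsion p) v,
      IsRamifiedOrdinaryLine W p L ∧
      L.greenbergKer κ.kerSubgroup = W.localKerOver p κ.kerSubgroup (v.adicCompletion ℚ) ∧
      L.strictKer κ.kerSubgroup = W.localKerOver p κ.kerSubgroup (v.adicCompletion ℚ) :=
  (ClassX3M.potMult W p hX).exists_isRamifiedOrdinaryLine_kummer hT40 hT41 (ClassX3M.p_ne_two W p hX)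
    κ hκ hv

end Classes

end Summit.BirchSwinnertonDyer.Rank1Residual.AdditivePotMult

end
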